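import Summits.QuantumFields.BalabanUV.Beta.GAN24.SourceBracketChannelChargeComb
import Summits.QuantumFields.BalabanUV.Beta.GAN24.T2DevConservationCapstone

/-!
# `BalabanUV.Beta.GAN24.SourceBracketCombOfS3c` — binder row G-an2-4 ∕ (CONV-C), W-slot CT-W, route «WC-TL» (A-0 END, rows (U) ∕ (U-drift) of the
# undressed-kernel comb-slot REFERENCE tower = this lineage's (B) `T2UndressedCombShapeEnd` p314162 ✓, PART 3 `T2UndressedCombDriftEnd` p316409 ✓, junction
# `T2UndressedCombJunction` p316684 ✓ — all MODULO the letter F2a-comb):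
# **F2a-comb OF THE REFERENCE TOWER ⟸ «S3C-REC» = THE THREE TWO-CONSTANT-LEG CONTRACTIONS OF THE RECURSIVE FIRST FIELD TABLE `unitS_j (SpureRecAt ρ … j)`,
# EVERY LEVEL — BY NAME, THROUGH ROAD W3's POINTWISE CHANNEL LEMMAS; MEMBER `0` OF «S3C-REC» DISCHARGED**

NOT IN PRINT; OUR BOOKKEEPING ([folklore] assembly BY NAME; G-an2-4 formalisation swarm, leaf prover `b2b-balaban-gan24-formalise-leaf-04`, gen 61; journal
INTENT I-leaf04-g61-1 «F2A-OF-S3C»; names PROVISIONAL — the OWNER gan24-p1 may rename ∕ re-cut).  HONEST FRAMING (cell contract, verbatim): «discharging `BetaPertH`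
makes Bałaban's UV stability UNCONDITIONAL — a real constructive-QFT result; it is NOT the continuum limit and NOT the Clay problem.»  HONEST DEPENDENCY (verbatim):
«continuum YM on T⁴ ⇐ BetaPertH ∧ nine spine estimates (0/9 proved); BetaPertH ⇐ (D1) ∧ (D4) ∧ CAP+tail; G-an2-4 gates asym, D1 and NE2/3/4.»

WHY.  The engine result R-leaf04-g61-1 (journal `CLAIMS.log` [LEAF04-G61-ONLINE]; kits j153398 ∕ j153492, D = 2, n = 3, two geometries per level): on the REFERENCE tower
(RAW comb slots `K♮_j = unitK (KInvStep Lc j)`, recursive tables `SpureRecAt ρ … j` with their DRESSED inner kernels) the four bond-summed channels of this lineage's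
PART 1 `SourceBracketChannelCharge.inner_value_unitKStep_eq` vanish POINTWISE in the first bond, CHANNEL BY CHANNEL, at levels 0 AND 1 (≤ 2e-17 ∕ 4e-19 against
Σ|charge| = 3e-2 ∕ 3e-5), and the three (S3c) contractions of `SpureRecAt ρ … j` against the raw kernel's SITE-FREE charges vanish at j = 0 AND j = 1 (≤ 6e-16).  So road
W3's POINTWISE Stage-B mechanism (leaf-06's `ChannelBondLegs` ∕ `ExchangeBondLegs`, instantiated for an2's `Spure`∕`M1` in `ResponseExchangeStep` §3) transfers VERBATIM to
the reference tower: its generic channel lemmas ask of the first field table ONLY a `LocStencil` shape, block covariance and the (S3c) triple.  This file makes that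
reduction a tree theorem and discharges the triple's member `0`; the member `j+1` (an inductive law through the dressed kernel's face-weighted charges and the
response columns — R-leaf04-g61-2, «route B») is the ONE located open content of F2a-comb and is NOT proved here.

WHAT ([folklore]; 0 `def`, 0 cited facts, 0 `def … : Prop`, 0 sorry):
* §1 `step_rates_rec` (one common rate for `K♮_j`, `unitS (SpureRecAt (toSite r) … j)`, `unitM (M1At (toSite r) cΛ j)` — an4's `decays_KInvStep`, an2's
  `locStencil_SpureRecAt` ∕ `vertexFamily_M1At` BY NAME), `unitS_SpureRecAt_translate` (an2's `SpureRecAt_translate` through the units).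
* §2 (generic `d`, any units `sf sm`, any in-block root, every `j`) **`hasSum_tsum_prod_resp_rec ∕ _resp_swap_rec ∕ _exchange_rec ∕ _exchange_swap_rec`** — the four
  channel bond series of PART 1 ∕ PART 2 (`hR₁ hR₂ hE₁ hE₂`) `HasSum … 0` at the COMB objects UNDER THE DISPLAYED HYPOTHESIS `h3` = the (S3c) triple for
  `unitS sf sm (SpureRecAt d Lc (toSite r) cE cVH cΛ j)` (the exact shape of `SpureChargeZero.hasSum_unitS_Spure … j κ a b s`): `ResponseExchangeStep` §3's four proofs with
  `Spure ↦ SpureRecAt (toSite r)`, `M1 ↦ M1At (toSite r)`.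
* §3 (`d = 3`, units `sfStep ∕ smStep`) **`hZ_comb_of_S3c`** — the `hZ` binder of (B) ∕ PART 3 (F2a-comb, BOTH conjuncts, EVERY level) ⟸ `hBt` ∧ «S3C-REC» — via PART 2
  `hZ_comb_of_cells` at `e₁ = e₂ = r₁ = r₂ := 0`; **`t2Shape_undressedComb_three_of_S3c`**, **`exists_hU_three_of_S3c_pinEq`** — rows (U) ∕ (U-drift) MODULO «S3C-REC» ONLY.
* §4 (`Lc` odd, the D1 pins, `Tc = (8N²)⁻¹ • wsym22 N`, `vh₂S = vh₂SAn1 Lc`) **`exists_allScalesSeq_JsRowD1Pin_of_S3c_C_QD`** — leaf-01 g63's CAPSTONE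
  `T2DevConservationCapstone.exists_allScalesSeq_JsRowD1Pin_of_F2a_C_QD` with `hZ := hZ_comb_of_S3c`: road FP's D1 literal `AllScalesSeq` row ⟸ {«S3C-REC», (C)sym, (Q-D),
  (Q-D-rate)} — the W-slot binder list of the literal with F2a-comb REPLACED by the table fact «S3C-REC», by ONE tree name.
* §5 **`hasSum_unitS_SpureRecAt_zero`** — MEMBER `0` OF «S3C-REC», every root ∕ units ∕ colour constants: the ff entries of `unitS sf sm (SpureRecAt ρ … 0)` are
  leaf-19's `(sf sm)⁻¹ sf⁻² cE · wilsonA` (the `vhSAt` border is off the ff block, `packVH_inl_inl`) ⇒ leaf-19's `WilsonVertexTwoConst.hasSum_wilsonA_*` close all three.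
HONEST: [folklore] bookkeeping; «S3C-REC» at members `j ≥ 1` is a HYPOTHESIS here (engine-certified at j = 1, D = 2 — decides nothing in the kernel); asserts NO value of
Bałaban's tables; discharges NOTHING of F2a-comb ∕ (U) ∕ (C) ∕ (Q-D) ∕ (Q-D-rate) ∕ «T2Shape» ∕ «T2Drift» ∕ (hW, hWall) unconditionally; NOT «D1 closed»; NEVER
«G-an2-4 closed» as (CONV-C); NOT D1, NOT `BetaPertH`, NOT continuum, NOT Clay.  2026-08-22.
-/

noncomputable section

open Finset
open scoped BigOperators
open Literature.MathematicalPhysics.QuantumFieldTheory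
open Literature.MathematicalPhysics.QuantumFieldTheory.Balaban1983to89
open Literature.MathematicalPhysics.QuantumFieldTheory.Balaban1983to89.Beta
open Literature.Probability.LatticeModels (Torus.proj)
open AffineAveraging (Site box toSite)
open ExpKernelCalculus (MKer Decays VertexFamily comp shiftK)
open OneStepResolventKernel (Fib LocStencil decays_mono)
open OneStepKernelFamily (KInvStep decays_KInvStep)
open SecondOrderResponse (dM K2OfK W2SymOfK)
open StepJetData (wilsonA)
open AveragingHessianKernels (packVH_inl_inl)
open AveragingMixedJetTables (mixFFAt)
open BalabanCompositeJets (LocStencil₂)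
open BalabanStepJets (locStencil_mono)
open BalabanStepW2 (K3OfK M2Of)
open BalabanStepJetsSucc (mmRead)
open Summit.QuantumFields.BalabanUV.Beta.HessKerDressedUnits (unitK unitS unitS_apply decays_unitK locStencil_unitS)
open Summit.QuantumFields.BalabanUV.Beta.SecondOrderUnits (unitM unitS₂ unitM₂)
open Summit.QuantumFields.BalabanUV.Beta.SpineRooted (T2RecOf SpureRecAt M1At locStencil_SpureRecAt vertexFamily_M1At SpureRecAt_translate
  M1At_translate SpureRecAt_zero_level)
open Summit.QuantumFields.BalabanUV.Beta.GAN24.CombesThomas (sfStep smStep)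
open Summit.QuantumFields.BalabanUV.Beta.GAN24.BiStencilZeroMode (Tab zmode)
open Summit.QuantumFields.BalabanUV.Beta.GAN24.MixedChannelZeroMode (shiftK_unitK_KInvStep)
open Summit.QuantumFields.BalabanUV.Beta.GAN24.ExchangeBondLegs (hasSum_bond_legs_exchange)
open Summit.QuantumFields.BalabanUV.Beta.GAN24.ChannelBondLegs (hasSum_tsum_prod_resp_bond hasSum_tsum_prod_resp_swap_bond
  hasSum_tsum_prod_exchange_swap_bond)
open Summit.QuantumFields.BalabanUV.Beta.GAN24.ResponseExchangeStep (unitKStep_off_left unitKStep_off_right unitKStep_row unitKStep_col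
  vertexFamily_unitM unitM_translate)
open Summit.QuantumFields.BalabanUV.Beta.GAN24.WilsonVertexTwoConst (unitS_inl_inl hasSum_wilsonA_legs hasSum_wilsonA_table_left hasSum_wilsonA_table_right)
open Summit.QuantumFields.BalabanUV.Beta.GAN24.SourceBracketChannelChargeComb (hZ_comb_of_cells)
open Summit.QuantumFields.BalabanUV.Beta.GAN24.T2UndressedCombShapeEnd (t2Shape_undressedComb_three_of_F2a)
open Summit.QuantumFields.BalabanUV.Beta.GAN24.T2UndressedCombDriftEnd (exists_hU_three_of_F2a_pinEq)
open RemainderConstAllScales (AllScalesSeq)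
open OneStepKernelFamily (TbalOf)
open AveragingContoursRooted (ctrOff ctrOff_mem_box)
open WilsonVertex2Sym (wsym22)
open Summit.QuantumFields.BalabanUV.Beta.AxialDressingRooted (dressKBmAt coProjBmAtK)
open Summit.QuantumFields.BalabanUV.Beta.SpineRooted (T2RecAt)
open Summit.QuantumFields.BalabanUV.Beta.SecondOrderSocketIdentification (vh₂SAn1 vh₂SAn1_inl_inl vh₂SAn1_inr_inr)
open Summit.QuantumFields.BalabanUV.Beta.SecondOrderTableLawEnd (locStencil₂_vh₂SAn1 vh₂SAn1_translate)
open Summit.QuantumFields.BalabanUV.Beta.RowD1JointEnd (JsRowD1Pin)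
open Summit.QuantumFields.BalabanUV.Beta.GAN24.T2DevConservationCapstone (exists_allScalesSeq_JsRowD1Pin_of_F2a_C_QD)

namespace Summit.QuantumFields.BalabanUV.Beta.GAN24.SourceBracketCombOfS3c

variable {d : ℕ} {Lc : ℕ} [NeZero Lc]

/-! ## §1 One common rate and block covariance of the comb objects -/

/-- [folklore] **ONE COMMON RATE** for the raw step kernel in units (an4's `decays_KInvStep`), the recursive first field table in units (an2's
`locStencil_SpureRecAt`, in-block root) and the rooted multiplier table in units (an2's `vertexFamily_M1At`, any rate) — `ResponseExchangeStep.step_rates` with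
`Spure ↦ SpureRecAt (toSite r)`, `M1 ↦ M1At (toSite r)`. -/
theorem step_rates_rec (hLc : 1 ≤ Lc) {r : Fin (d + 1) → ℕ} (hr : r ∈ box (d + 1) Lc) (sf sm cE cVH cΛ : ℝ) (j : ℕ) :
    ∃ C Cs CM m : ℝ, 0 < m ∧ Decays (unitK sf sm (KInvStep (d := d) Lc j)) C m ∧
      LocStencil (unitS sf sm (SpureRecAt d Lc (toSite r) cE cVH cΛ j)) Cs m ∧
      VertexFamily (unitM sf sm (M1At d Lc (toSite r) cΛ j)) Lc CM m := by
  obtain ⟨δK, CK, hδK, hCK, hK⟩ := decays_KInvStep (d := d) (Lc := Lc) j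
  obtain ⟨Cs, δS, hδS, hS⟩ := locStencil_SpureRecAt (d := d) (Lc := Lc) hLc hr cE cVH cΛ j
  have hm : 0 < min δK δS := lt_min hδK hδS
  have hCs : 0 ≤ Cs := (hS 0 0).nonneg (Sum.inl 0)
  exact ⟨_, _, _, min δK δS, hm, decays_mono (decays_unitK hK) (by positivity) le_rfl (min_le_left _ _),
    locStencil_mono (locStencil_unitS hS) (by positivity) (min_le_right _ _),
    vertexFamily_unitM (vertexFamily_M1At hLc hr cΛ j hm.le) sf sm⟩

/-- [folklore] **BLOCK COVARIANCE OF THE NORMALISED RECURSIVE FIRST FIELD TABLE** (an2's `SpureRecAt_translate`; leg-type-constant units commute with shifts). -/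
theorem unitS_SpureRecAt_translate (ρ : Fin (d + 1) → ℤ) (hLc : 1 ≤ Lc) (sf sm cE cVH cΛ : ℝ) (j : ℕ) (κ : Fin (d + 1)) (u s : Site (d + 1)) :
    unitS sf sm (SpureRecAt d Lc ρ cE cVH cΛ j) κ (u + ((Lc : ℕ) : ℤ) • s)
      = shiftK (-(((Lc : ℕ) : ℤ) • s)) (unitS sf sm (SpureRecAt d Lc ρ cE cVH cΛ j) κ u) := by
  funext x z a b
  simp only [unitS_apply, shiftK, SpureRecAt_translate ρ hLc cE cVH cΛ j κ u s]

/-! ## §2 The four channel bond series at the comb objects, MODULO the (S3c) triple of `unitS_j (SpureRecAt ρ … j)` -/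

section Channels

variable (hLc : 1 ≤ Lc) {r : Fin (d + 1) → ℕ} (hr : r ∈ box (d + 1) Lc) (sf sm cE cVH cΛ : ℝ) (j : ℕ)
  (h3 : ∀ (κ : Fin (d + 1)) (a b : Fin (d + 1)) (s : Site (d + 1)),
    HasSum (fun p : Site (d + 1) × Site (d + 1) =>
        unitS sf sm (SpureRecAt d Lc (toSite r) cE cVH cΛ j) κ s p.1 p.2 (Sum.inl a) (Sum.inl b)) 0 ∧
      HasSum (fun p : Site (d + 1) × Site (d + 1) =>
        unitS sf sm (SpureRecAt d Lc (toSite r) cE cVH cΛ j) κ p.1 p.2 s (Sum.inl a) (Sum.inl b)) 0 ∧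
      HasSum (fun p : Site (d + 1) × Site (d + 1) =>
        unitS sf sm (SpureRecAt d Lc (toSite r) cE cVH cΛ j) κ p.1 s p.2 (Sum.inl a) (Sum.inl b)) 0)
include hLc hr h3

/-- NOT IN PRINT; OUR BOOKKEEPING ([folklore]; leaf-06's `ChannelBondLegs.hasSum_tsum_prod_resp_bond` at the comb objects).  **SECOND-RESPONSE CHANNEL `hR₁`, MODULO
(S3c)(i)∧(ii) OF `unitS_j (SpureRecAt ρ … j)`**: `HasSum (u′ ↦ Σ'_{(v,p)} dM (K2OfK K♮_j Lc S♮_j M♮_j κ′ u′) Lc S♮_j M♮_j κ u v p (inl a) (inl b)) 0` for every first bond. -/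
theorem hasSum_tsum_prod_resp_rec (κ : Fin (d + 1)) (u : Site (d + 1)) (κ' a b : Fin (d + 1)) :
    HasSum (fun u' : Site (d + 1) => ∑' vp : Site (d + 1) × Site (d + 1),
      dM (K2OfK (unitK sf sm (KInvStep (d := d) Lc j)) Lc (unitS sf sm (SpureRecAt d Lc (toSite r) cE cVH cΛ j))
          (unitM sf sm (M1At d Lc (toSite r) cΛ j)) κ' u')
        Lc (unitS sf sm (SpureRecAt d Lc (toSite r) cE cVH cΛ j)) (unitM sf sm (M1At d Lc (toSite r) cΛ j)) κ u vp.1 vp.2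
        (Sum.inl a) (Sum.inl b)) 0 := by
  obtain ⟨C, Cs, CM, m, hm, hK, hS, hM⟩ := step_rates_rec (d := d) hLc hr sf sm cE cVH cΛ j
  exact hasSum_tsum_prod_resp_bond hK hm (unitKStep_row sf sm j) (unitKStep_col sf sm j) (fun α μ => by simp) (fun β μ => by simp)
    (fun x z ρ b hx => unitKStep_off_left sf sm j x z ρ b hx) hS
    (fun κ t a b => (h3 κ a b t).1) (fun κ q a b => (h3 κ a b q).2.1)
    (unitS_SpureRecAt_translate (toSite r) hLc sf sm cE cVH cΛ j) hM (unitM_translate (M1At_translate (Lc := Lc) (toSite r) cΛ j) sf sm)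
    κ u κ' a b

/-- NOT IN PRINT; OUR BOOKKEEPING ([folklore]; leaf-06's `ChannelBondLegs.hasSum_tsum_prod_resp_swap_bond`).  **SECOND-RESPONSE CHANNEL `hR₂` (swapped), MODULO
(S3c)(i)**: `HasSum (u′ ↦ Σ'_{(v,p)} dM (K2OfK K♮_j Lc S♮_j M♮_j κ u) Lc S♮_j M♮_j κ′ u′ v p (inl a) (inl b)) 0`. -/
theorem hasSum_tsum_prod_resp_swap_rec (κ : Fin (d + 1)) (u : Site (d + 1)) (κ' a b : Fin (d + 1)) :
    HasSum (fun u' : Site (d + 1) => ∑' vp : Site (d + 1) × Site (d + 1),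
      dM (K2OfK (unitK sf sm (KInvStep (d := d) Lc j)) Lc (unitS sf sm (SpureRecAt d Lc (toSite r) cE cVH cΛ j))
          (unitM sf sm (M1At d Lc (toSite r) cΛ j)) κ u)
        Lc (unitS sf sm (SpureRecAt d Lc (toSite r) cE cVH cΛ j)) (unitM sf sm (M1At d Lc (toSite r) cΛ j)) κ' u' vp.1 vp.2
        (Sum.inl a) (Sum.inl b)) 0 := by
  obtain ⟨C, Cs, CM, m, hm, hK, hS, hM⟩ := step_rates_rec (d := d) hLc hr sf sm cE cVH cΛ j
  exact hasSum_tsum_prod_resp_swap_bond hK hm (unitKStep_row sf sm j) (unitKStep_col sf sm j) (fun α μ => by simp) (fun β μ => by simp) hS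
    (fun κ t a b => (h3 κ a b t).1)
    hM (unitM_translate (M1At_translate (Lc := Lc) (toSite r) cΛ j) sf sm) κ u κ' a b

/-- NOT IN PRINT; OUR BOOKKEEPING ([folklore]; leaf-06's `ExchangeBondLegs.hasSum_bond_legs_exchange`).  **EXCHANGE CHANNEL `hE₁`, MODULO (S3c)(i)∧(iii)**:
`HasSum (u′ ↦ Σ'_{(v,w)} ((dM K♮_j Lc S♮_j M♮_j κ u ∘ K♮_j) ∘ dM K♮_j Lc S♮_j M♮_j κ′ u′)(v, w)_{(inl a, inl b)}) 0`. -/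
theorem hasSum_tsum_prod_exchange_rec (κ : Fin (d + 1)) (u : Site (d + 1)) (κ' a b : Fin (d + 1)) :
    HasSum (fun u' : Site (d + 1) => ∑' vw : Site (d + 1) × Site (d + 1),
      comp (comp (dM (unitK sf sm (KInvStep (d := d) Lc j)) Lc (unitS sf sm (SpureRecAt d Lc (toSite r) cE cVH cΛ j))
          (unitM sf sm (M1At d Lc (toSite r) cΛ j)) κ u) (unitK sf sm (KInvStep (d := d) Lc j)))
        (dM (unitK sf sm (KInvStep (d := d) Lc j)) Lc (unitS sf sm (SpureRecAt d Lc (toSite r) cE cVH cΛ j))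
          (unitM sf sm (M1At d Lc (toSite r) cΛ j)) κ' u')
        vw.1 vw.2 (Sum.inl a) (Sum.inl b)) 0 := by
  obtain ⟨C, Cs, CM, m, hm, hK, hS, hM⟩ := step_rates_rec (d := d) hLc hr sf sm cE cVH cΛ j
  exact hasSum_bond_legs_exchange hK hm (unitKStep_row sf sm j) (unitKStep_col sf sm j) (fun α μ => by simp) (fun β μ => by simp)
    (fun x z a ρ hz => unitKStep_off_right sf sm j x z a ρ hz) hS
    (fun κ t a b => (h3 κ a b t).1) (fun κ p a b => (h3 κ a b p).2.2)
    (unitS_SpureRecAt_translate (toSite r) hLc sf sm cE cVH cΛ j) hM (unitM_translate (M1At_translate (Lc := Lc) (toSite r) cΛ j) sf sm)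
    κ u κ' a b

/-- NOT IN PRINT; OUR BOOKKEEPING ([folklore]; leaf-06's `ChannelBondLegs.hasSum_tsum_prod_exchange_swap_bond`).  **EXCHANGE CHANNEL `hE₂` (swapped), MODULO
(S3c)(i)∧(iii)**: `HasSum (u′ ↦ Σ'_{(v,w)} ((dM K♮_j Lc S♮_j M♮_j κ′ u′ ∘ K♮_j) ∘ dM K♮_j Lc S♮_j M♮_j κ u)(v, w)_{(inl a, inl b)}) 0`. -/
theorem hasSum_tsum_prod_exchange_swap_rec (κ : Fin (d + 1)) (u : Site (d + 1)) (κ' a b : Fin (d + 1)) :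
    HasSum (fun u' : Site (d + 1) => ∑' vw : Site (d + 1) × Site (d + 1),
      comp (comp (dM (unitK sf sm (KInvStep (d := d) Lc j)) Lc (unitS sf sm (SpureRecAt d Lc (toSite r) cE cVH cΛ j))
          (unitM sf sm (M1At d Lc (toSite r) cΛ j)) κ' u') (unitK sf sm (KInvStep (d := d) Lc j)))
        (dM (unitK sf sm (KInvStep (d := d) Lc j)) Lc (unitS sf sm (SpureRecAt d Lc (toSite r) cE cVH cΛ j))
          (unitM sf sm (M1At d Lc (toSite r) cΛ j)) κ u)
        vw.1 vw.2 (Sum.inl a) (Sum.inl b)) 0 := by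
  obtain ⟨C, Cs, CM, m, hm, hK, hS, hM⟩ := step_rates_rec (d := d) hLc hr sf sm cE cVH cΛ j
  exact hasSum_tsum_prod_exchange_swap_bond hK hm (shiftK_unitK_KInvStep sf sm j) (unitKStep_row sf sm j) (unitKStep_col sf sm j)
    (fun α μ => by simp) (fun β μ => by simp) (fun x z a ρ hz => unitKStep_off_right sf sm j x z a ρ hz) hS
    (fun κ t a b => (h3 κ a b t).1) (fun κ p a b => (h3 κ a b p).2.2)
    (unitS_SpureRecAt_translate (toSite r) hLc sf sm cE cVH cΛ j) hM (unitM_translate (M1At_translate (Lc := Lc) (toSite r) cΛ j) sf sm)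
    κ u κ' a b

end Channels

/-! ## §3 `d = 3`: F2a-comb and the rows (U) ∕ (U-drift) MODULO «S3C-REC» -/

section Three

variable {r : Fin (3 + 1) → ℕ}

/-- NOT IN PRINT; OUR BOOKKEEPING ([folklore]; §2 at the units `sfStep ∕ smStep` ⇒ PART 2 `hZ_comb_of_cells` at `e₁ = e₂ = r₁ = r₂ := 0`, the cell identity being `Σ 0 = 0`).
**F2a-comb OF THE REFERENCE TOWER ⟸ «S3C-REC»**: for `2 ≤ Lc`, an in-block root `r`, every `cE cVH cΛ cE₂ cB Tc`, a jointly `Lc`-covariant off-diagonal `LocStencil₂` border,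
IF at every level `i` the recursive first field table in units `unitS_i (SpureRecAt 3 Lc (toSite r) cE cVH cΛ i)` has its three two-constant-leg ff contractions ZERO
(hypothesis `h3`, the shape of `SpureChargeZero.hasSum_unitS_Spure`), then the `hZ` binder («F2a-comb», both conjuncts, every level) of this lineage's
`T2UndressedCombShapeEnd.t2Shape_undressedComb_three_of_F2a` ∕ `T2UndressedCombDriftEnd.exists_hU_three_of_F2a_pinEq` holds TOKEN FOR TOKEN. -/
theorem hZ_comb_of_S3c (hLc : 2 ≤ Lc) (hr : r ∈ box (3 + 1) Lc) (cE cVH cΛ cE₂ cB : ℝ)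
    (Tc : Fin 4 → Fin 4 → Fin 4 → Fin 4 → ℝ) {vh₂S : Tab 3}
    (hBff : ∀ κ u κ' u' x z (α β : Fin (3 + 1)), vh₂S κ u κ' u' x z (Sum.inl α) (Sum.inl β) = 0)
    (hBmm : ∀ κ u κ' u' x z (μ ν : Fin (3 + 1)), vh₂S κ u κ' u' x z (Sum.inr μ) (Sum.inr ν) = 0)
    {CB δB : ℝ} (hB : LocStencil₂ vh₂S CB δB) (hδB : 0 < δB)
    (hBt : ∀ (κ : Fin (3 + 1)) (u : Fin (3 + 1) → ℤ) (κ' : Fin (3 + 1)) (u' t : Fin (3 + 1) → ℤ),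
      vh₂S κ (u + (Lc : ℤ) • t) κ' (u' + (Lc : ℤ) • t) = shiftK (-((Lc : ℤ) • t)) (vh₂S κ u κ' u'))
    (h3 : ∀ (i : ℕ) (κ : Fin (3 + 1)) (a b : Fin (3 + 1)) (s : Site (3 + 1)),
      HasSum (fun p : Site (3 + 1) × Site (3 + 1) =>
          unitS (sfStep Lc i) (smStep 3 Lc i) (SpureRecAt 3 Lc (toSite r) cE cVH cΛ i) κ s p.1 p.2 (Sum.inl a) (Sum.inl b)) 0 ∧
        HasSum (fun p : Site (3 + 1) × Site (3 + 1) =>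
          unitS (sfStep Lc i) (smStep 3 Lc i) (SpureRecAt 3 Lc (toSite r) cE cVH cΛ i) κ p.1 p.2 s (Sum.inl a) (Sum.inl b)) 0 ∧
        HasSum (fun p : Site (3 + 1) × Site (3 + 1) =>
          unitS (sfStep Lc i) (smStep 3 Lc i) (SpureRecAt 3 Lc (toSite r) cE cVH cΛ i) κ p.1 s p.2 (Sum.inl a) (Sum.inl b)) 0) :
    ∀ i : ℕ,
      (∀ κ u κ' u' t,
          (cE₂ * (Lc : ℝ) ^ (2 * (3 + 1))) •
              mmRead Lc (K3OfK (unitK (sfStep Lc i) (smStep 3 Lc i) (KInvStep (d := 3) Lc i)) Lc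
              (unitS (sfStep Lc i) (smStep 3 Lc i) (SpureRecAt 3 Lc (toSite r) cE cVH cΛ i)) (unitM (sfStep Lc i) (smStep 3 Lc i) (M1At 3 Lc (toSite r) cΛ i))
              (W2SymOfK (unitK (sfStep Lc i) (smStep 3 Lc i) (KInvStep (d := 3) Lc i)) Lc
                (unitS (sfStep Lc i) (smStep 3 Lc i) (SpureRecAt 3 Lc (toSite r) cE cVH cΛ i)) (unitM (sfStep Lc i) (smStep 3 Lc i) (M1At 3 Lc (toSite r) cΛ i)) 0
                (unitM₂ (sfStep Lc i) (smStep 3 Lc i) (M2Of 3 Lc (mixFFAt (toSite r) Lc) i))) κ (u + (Lc : ℤ) • t) κ' (u' + (Lc : ℤ) • t)) + cB • vh₂S κ (u + (Lc : ℤ) • t) κ' (u' + (Lc : ℤ) • t) =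
        shiftK (-((Lc : ℤ) • t)) ((cE₂ * (Lc : ℝ) ^ (2 * (3 + 1))) •
              mmRead Lc (K3OfK (unitK (sfStep Lc i) (smStep 3 Lc i) (KInvStep (d := 3) Lc i)) Lc
              (unitS (sfStep Lc i) (smStep 3 Lc i) (SpureRecAt 3 Lc (toSite r) cE cVH cΛ i)) (unitM (sfStep Lc i) (smStep 3 Lc i) (M1At 3 Lc (toSite r) cΛ i))
              (W2SymOfK (unitK (sfStep Lc i) (smStep 3 Lc i) (KInvStep (d := 3) Lc i)) Lc
                (unitS (sfStep Lc i) (smStep 3 Lc i) (SpureRecAt 3 Lc (toSite r) cE cVH cΛ i)) (unitM (sfStep Lc i) (smStep 3 Lc i) (M1At 3 Lc (toSite r) cΛ i)) 0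
                (unitM₂ (sfStep Lc i) (smStep 3 Lc i) (M2Of 3 Lc (mixFFAt (toSite r) Lc) i))) κ u κ' u') + cB • vh₂S κ u κ' u')) ∧
      (∀ κ κ' κ₁ κ₂,
        zmode Lc (fun κ u κ' u' => (cE₂ * (Lc : ℝ) ^ (2 * (3 + 1))) •
              mmRead Lc (K3OfK (unitK (sfStep Lc i) (smStep 3 Lc i) (KInvStep (d := 3) Lc i)) Lc
              (unitS (sfStep Lc i) (smStep 3 Lc i) (SpureRecAt 3 Lc (toSite r) cE cVH cΛ i)) (unitM (sfStep Lc i) (smStep 3 Lc i) (M1At 3 Lc (toSite r) cΛ i))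
              (W2SymOfK (unitK (sfStep Lc i) (smStep 3 Lc i) (KInvStep (d := 3) Lc i)) Lc
                (unitS (sfStep Lc i) (smStep 3 Lc i) (SpureRecAt 3 Lc (toSite r) cE cVH cΛ i)) (unitM (sfStep Lc i) (smStep 3 Lc i) (M1At 3 Lc (toSite r) cΛ i)) 0
                (unitM₂ (sfStep Lc i) (smStep 3 Lc i) (M2Of 3 Lc (mixFFAt (toSite r) Lc) i))) κ u κ' u') + cB • vh₂S κ u κ' u') κ κ' (Sum.inl κ₁) (Sum.inl κ₂) +
        zmode Lc (fun κ u κ' u' => (cE₂ * (Lc : ℝ) ^ (2 * (3 + 1))) •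
              mmRead Lc (K3OfK (unitK (sfStep Lc i) (smStep 3 Lc i) (KInvStep (d := 3) Lc i)) Lc
              (unitS (sfStep Lc i) (smStep 3 Lc i) (SpureRecAt 3 Lc (toSite r) cE cVH cΛ i)) (unitM (sfStep Lc i) (smStep 3 Lc i) (M1At 3 Lc (toSite r) cΛ i))
              (W2SymOfK (unitK (sfStep Lc i) (smStep 3 Lc i) (KInvStep (d := 3) Lc i)) Lc
                (unitS (sfStep Lc i) (smStep 3 Lc i) (SpureRecAt 3 Lc (toSite r) cE cVH cΛ i)) (unitM (sfStep Lc i) (smStep 3 Lc i) (M1At 3 Lc (toSite r) cΛ i)) 0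
                (unitM₂ (sfStep Lc i) (smStep 3 Lc i) (M2Of 3 Lc (mixFFAt (toSite r) Lc) i))) κ u κ' u') + cB • vh₂S κ u κ' u') κ' κ (Sum.inl κ₁) (Sum.inl κ₂) = 0) := by
  have hLc1 : 1 ≤ Lc := le_trans (by norm_num) hLc
  refine hZ_comb_of_cells hLc hr cE cVH cΛ cE₂ cB Tc hBff hBmm hB hδB hBt
    (e₁ := fun _ _ _ _ _ _ => 0) (e₂ := fun _ _ _ _ _ _ => 0) (r₁ := fun _ _ _ _ _ _ => 0) (r₂ := fun _ _ _ _ _ _ => 0)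
    (fun i α β κ u κ' => hasSum_tsum_prod_exchange_rec hLc1 hr (sfStep Lc i) (smStep 3 Lc i) cE cVH cΛ i (h3 i) κ u κ' α β)
    (fun i α β κ u κ' => hasSum_tsum_prod_exchange_swap_rec hLc1 hr (sfStep Lc i) (smStep 3 Lc i) cE cVH cΛ i (h3 i) κ u κ' α β)
    (fun i α β κ u κ' => hasSum_tsum_prod_resp_rec hLc1 hr (sfStep Lc i) (smStep 3 Lc i) cE cVH cΛ i (h3 i) κ u κ' α β)
    (fun i α β κ u κ' => hasSum_tsum_prod_resp_swap_rec hLc1 hr (sfStep Lc i) (smStep 3 Lc i) cE cVH cΛ i (h3 i) κ u κ' α β)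
    (fun i α β κ κ' => by simp)

/-- NOT IN PRINT; OUR PROOF ATTEMPT ([folklore] (B) `t2Shape_undressedComb_three_of_F2a` with `hZ := hZ_comb_of_S3c`).  **ROW (U) — «T2Shape» OF THE UNDRESSED-KERNEL
COMB-SLOT REFERENCE TOWER MODULO «S3C-REC»** (`d = 3`, pin `cE = Lc⁴`, `|cE₂| ≤ Lc⁸`, every `cVH cΛ cB Tc`, every jointly covariant off-diagonal `LocStencil₂` border). -/
theorem t2Shape_undressedComb_three_of_S3c (hLc : 2 ≤ Lc) (hr : r ∈ box (3 + 1) Lc) {cE : ℝ} (hcE : cE = (Lc : ℝ) ^ (3 + 1)) (cVH cΛ cE₂ cB : ℝ)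
    (Tc : Fin 4 → Fin 4 → Fin 4 → Fin 4 → ℝ) {vh₂S : Tab 3}
    (hBff : ∀ κ u κ' u' x z (α β : Fin (3 + 1)), vh₂S κ u κ' u' x z (Sum.inl α) (Sum.inl β) = 0)
    (hBmm : ∀ κ u κ' u' x z (μ ν : Fin (3 + 1)), vh₂S κ u κ' u' x z (Sum.inr μ) (Sum.inr ν) = 0)
    {CB δB : ℝ} (hB : LocStencil₂ vh₂S CB δB) (hδB : 0 < δB)
    (hBt : ∀ (κ : Fin (3 + 1)) (u : Fin (3 + 1) → ℤ) (κ' : Fin (3 + 1)) (u' t : Fin (3 + 1) → ℤ),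
      vh₂S κ (u + (Lc : ℤ) • t) κ' (u' + (Lc : ℤ) • t) = shiftK (-((Lc : ℤ) • t)) (vh₂S κ u κ' u'))
    (hpin : |cE₂| ≤ (Lc : ℝ) ^ (2 * (3 + 1)))
    (h3 : ∀ (i : ℕ) (κ : Fin (3 + 1)) (a b : Fin (3 + 1)) (s : Site (3 + 1)),
      HasSum (fun p : Site (3 + 1) × Site (3 + 1) =>
          unitS (sfStep Lc i) (smStep 3 Lc i) (SpureRecAt 3 Lc (toSite r) cE cVH cΛ i) κ s p.1 p.2 (Sum.inl a) (Sum.inl b)) 0 ∧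
        HasSum (fun p : Site (3 + 1) × Site (3 + 1) =>
          unitS (sfStep Lc i) (smStep 3 Lc i) (SpureRecAt 3 Lc (toSite r) cE cVH cΛ i) κ p.1 p.2 s (Sum.inl a) (Sum.inl b)) 0 ∧
        HasSum (fun p : Site (3 + 1) × Site (3 + 1) =>
          unitS (sfStep Lc i) (smStep 3 Lc i) (SpureRecAt 3 Lc (toSite r) cE cVH cΛ i) κ p.1 s p.2 (Sum.inl a) (Sum.inl b)) 0) :
    ∃ C₂ δ₂ : ℝ, 0 < δ₂ ∧ ∀ j, LocStencil₂ (unitS₂ (sfStep Lc j) (smStep 3 Lc j)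
      (T2RecOf 3 Lc (fun j => KInvStep (d := 3) Lc j) (SpureRecAt 3 Lc (toSite r) cE cVH cΛ) (M1At 3 Lc (toSite r) cΛ) cE₂ cB Tc vh₂S
        (mixFFAt (toSite r) Lc) j)) C₂ δ₂ :=
  t2Shape_undressedComb_three_of_F2a hLc hr hcE cVH cΛ cE₂ cB Tc hBff hBmm hB hδB hpin
    (hZ_comb_of_S3c hLc hr cE cVH cΛ cE₂ cB Tc hBff hBmm hB hδB hBt h3)

/-- NOT IN PRINT; OUR PROOF ATTEMPT ([folklore] PART 3 `exists_hU_three_of_F2a_pinEq` with `hZ := hZ_comb_of_S3c`).  **ROW (U-drift) — THE OWNER's `hU` QUINTUPLE FOR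
THE REFERENCE TOWER MODULO «S3C-REC»** (`d = 3`, pin `cE = Lc⁴`, EXACT pin `cE₂ = Lc⁸`). -/
theorem exists_hU_three_of_S3c_pinEq (hLc : 2 ≤ Lc) (hr : r ∈ box (3 + 1) Lc) {cE : ℝ} (hcE : cE = (Lc : ℝ) ^ (3 + 1)) (cVH cΛ cE₂ cB : ℝ)
    (Tc : Fin 4 → Fin 4 → Fin 4 → Fin 4 → ℝ) {vh₂S : Tab 3}
    (hBff : ∀ κ u κ' u' x z (α β : Fin (3 + 1)), vh₂S κ u κ' u' x z (Sum.inl α) (Sum.inl β) = 0)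
    (hBmm : ∀ κ u κ' u' x z (μ ν : Fin (3 + 1)), vh₂S κ u κ' u' x z (Sum.inr μ) (Sum.inr ν) = 0)
    {CB δB : ℝ} (hB : LocStencil₂ vh₂S CB δB) (hδB : 0 < δB)
    (hBt : ∀ (κ : Fin (3 + 1)) (u : Fin (3 + 1) → ℤ) (κ' : Fin (3 + 1)) (u' t : Fin (3 + 1) → ℤ),
      vh₂S κ (u + (Lc : ℤ) • t) κ' (u' + (Lc : ℤ) • t) = shiftK (-((Lc : ℤ) • t)) (vh₂S κ u κ' u'))
    (hpinEq : cE₂ = (Lc : ℝ) ^ (2 * (3 + 1)))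
    (h3 : ∀ (i : ℕ) (κ : Fin (3 + 1)) (a b : Fin (3 + 1)) (s : Site (3 + 1)),
      HasSum (fun p : Site (3 + 1) × Site (3 + 1) =>
          unitS (sfStep Lc i) (smStep 3 Lc i) (SpureRecAt 3 Lc (toSite r) cE cVH cΛ i) κ s p.1 p.2 (Sum.inl a) (Sum.inl b)) 0 ∧
        HasSum (fun p : Site (3 + 1) × Site (3 + 1) =>
          unitS (sfStep Lc i) (smStep 3 Lc i) (SpureRecAt 3 Lc (toSite r) cE cVH cΛ i) κ p.1 p.2 s (Sum.inl a) (Sum.inl b)) 0 ∧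
        HasSum (fun p : Site (3 + 1) × Site (3 + 1) =>
          unitS (sfStep Lc i) (smStep 3 Lc i) (SpureRecAt 3 Lc (toSite r) cE cVH cΛ i) κ p.1 s p.2 (Sum.inl a) (Sum.inl b)) 0) :
    ∃ cU ϑU δU : ℝ, 0 ≤ cU ∧ 0 ≤ ϑU ∧ ϑU < 1 ∧ 0 < δU ∧
      ∀ n : ℕ, LocStencil₂ ((fun n : ℕ => unitS₂ (sfStep Lc n) (smStep 3 Lc n)
            (T2RecOf 3 Lc (fun j => KInvStep (d := 3) Lc j) (SpureRecAt 3 Lc (toSite r) cE cVH cΛ) (M1At 3 Lc (toSite r) cΛ) cE₂ cB Tc vh₂S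
              (mixFFAt (toSite r) Lc) n)) (n + 1) -
          (fun n : ℕ => unitS₂ (sfStep Lc n) (smStep 3 Lc n)
            (T2RecOf 3 Lc (fun j => KInvStep (d := 3) Lc j) (SpureRecAt 3 Lc (toSite r) cE cVH cΛ) (M1At 3 Lc (toSite r) cΛ) cE₂ cB Tc vh₂S
              (mixFFAt (toSite r) Lc) n)) n) (cU * ϑU ^ n) δU :=
  exists_hU_three_of_F2a_pinEq hLc hr hcE cVH cΛ cE₂ cB Tc hBff hBmm hB hδB hBt hpinEq
    (hZ_comb_of_S3c hLc hr cE cVH cΛ cE₂ cB Tc hBff hBmm hB hδB hBt h3)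

end Three

/-! ## §4 Road FP's D1 literal of record: the W-slot binder list with F2a-comb REPLACED by «S3C-REC» -/

section Literal

variable {r : Fin (3 + 1) → ℕ}

/-- NOT IN PRINT; OUR PROOF ATTEMPT ([folklore] leaf-01's CAPSTONE `T2DevConservationCapstone.exists_allScalesSeq_JsRowD1Pin_of_F2a_C_QD` with `hZ := hZ_comb_of_S3c` at the
literal border `vh₂SAn1 Lc` — off-diagonal (`vh₂SAn1_inl_inl ∕ _inr_inr`), `LocStencil₂` at odd `Lc` (`locStencil₂_vh₂SAn1`), jointly covariant (`vh₂SAn1_translate`)).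
**ROAD FP's D1 LITERAL OF RECORD MODULO «S3C-REC» ∧ (C) ∧ (Q-D) ∧ (Q-D-rate)** (`Lc` odd, `Lc ≥ 2`, colour `N`; data pinned by equations exactly as in the capstone):
the W-slot binder list of the literal reads, BY ONE TREE NAME, {«S3C-REC» (= `h3`, member `0` discharged in §4), (C)sym, (Q-D), (Q-D-rate)} — F2a-comb is no longer a
letter of its own.  CONDITIONAL on the four rows; NOT «D1 closed»; NEVER «G-an2-4 closed» as (CONV-C); NOT D1, NOT `BetaPertH`, NOT continuum, NOT Clay. -/
theorem exists_allScalesSeq_JsRowD1Pin_of_S3c_C_QD (hodd : Odd Lc) (hLc : 2 ≤ Lc) (N : ℕ) {cE cVH cΛ cE₂ cB : ℝ}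
    {Tc : Fin 4 → Fin 4 → Fin 4 → Fin 4 → ℝ} {vh₂S : Tab 3}
    (hρ : r = ctrOff (3 + 1) Lc) (hcE : cE = (Lc : ℝ) ^ 4) (hcVH : cVH = -((Lc : ℝ) ^ 8 / 2)) (hcΛ : cΛ = 2 / (Lc : ℝ) ^ 4) (hcE₂ : cE₂ = (Lc : ℝ) ^ 8)
    (hcB : cB = -((Lc : ℝ) ^ 12 / 4)) (hTc : Tc = (8 * (N : ℝ) ^ 2)⁻¹ • wsym22 N) (hvh : vh₂S = vh₂SAn1 Lc)
    (h3 : ∀ (i : ℕ) (κ : Fin (3 + 1)) (a b : Fin (3 + 1)) (s : Site (3 + 1)),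
      HasSum (fun p : Site (3 + 1) × Site (3 + 1) =>
          unitS (sfStep Lc i) (smStep 3 Lc i) (SpureRecAt 3 Lc (toSite r) cE cVH cΛ i) κ s p.1 p.2 (Sum.inl a) (Sum.inl b)) 0 ∧
        HasSum (fun p : Site (3 + 1) × Site (3 + 1) =>
          unitS (sfStep Lc i) (smStep 3 Lc i) (SpureRecAt 3 Lc (toSite r) cE cVH cΛ i) κ p.1 p.2 s (Sum.inl a) (Sum.inl b)) 0 ∧
        HasSum (fun p : Site (3 + 1) × Site (3 + 1) =>
          unitS (sfStep Lc i) (smStep 3 Lc i) (SpureRecAt 3 Lc (toSite r) cE cVH cΛ i) κ p.1 s p.2 (Sum.inl a) (Sum.inl b)) 0)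
    {CY δY CY' θY δY' : ℝ}
    (hC : ∀ (i : ℕ) (κ κ' κ₁ κ₂ : Fin (3 + 1)),
      zmode Lc (unitS₂ (sfStep Lc i) (smStep 3 Lc i) (T2RecAt 3 Lc (toSite r) cE cVH cΛ cE₂ cB Tc vh₂S (mixFFAt (toSite r) Lc) i)) κ κ' (Sum.inl κ₁) (Sum.inl κ₂)
          + zmode Lc (unitS₂ (sfStep Lc i) (smStep 3 Lc i) (T2RecAt 3 Lc (toSite r) cE cVH cΛ cE₂ cB Tc vh₂S (mixFFAt (toSite r) Lc) i)) κ' κ (Sum.inl κ₁) (Sum.inl κ₂)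
        = zmode Lc (unitS₂ (sfStep Lc i) (smStep 3 Lc i) (T2RecOf 3 Lc (fun j => KInvStep (d := 3) Lc j) (SpureRecAt 3 Lc (toSite r) cE cVH cΛ) (M1At 3 Lc (toSite r) cΛ) cE₂ cB Tc vh₂S (mixFFAt (toSite r) Lc) i)) κ κ' (Sum.inl κ₁) (Sum.inl κ₂)
          + zmode Lc (unitS₂ (sfStep Lc i) (smStep 3 Lc i) (T2RecOf 3 Lc (fun j => KInvStep (d := 3) Lc j) (SpureRecAt 3 Lc (toSite r) cE cVH cΛ) (M1At 3 Lc (toSite r) cΛ) cE₂ cB Tc vh₂S (mixFFAt (toSite r) Lc) i)) κ' κ (Sum.inl κ₁) (Sum.inl κ₂))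
    (hY : ∀ m : ℕ, LocStencil₂ ((fun κ u κ' u' => dressKBmAt (toSite r) Lc (coProjBmAtK (toSite r) Lc (fun κ₁ u₁ => coProjBmAtK (toSite r) Lc
            ((unitS₂ (sfStep Lc m) (smStep 3 Lc m) (T2RecAt 3 Lc (toSite r) cE cVH cΛ cE₂ cB Tc vh₂S (mixFFAt (toSite r) Lc) m)) κ₁ u₁) κ' u') κ u)) -
          (unitS₂ (sfStep Lc m) (smStep 3 Lc m) (T2RecAt 3 Lc (toSite r) cE cVH cΛ cE₂ cB Tc vh₂S (mixFFAt (toSite r) Lc) m))) CY δY) (hδY : 0 < δY)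
    (hYr : ∀ m : ℕ, LocStencil₂ (((fun κ u κ' u' => dressKBmAt (toSite r) Lc (coProjBmAtK (toSite r) Lc (fun κ₁ u₁ => coProjBmAtK (toSite r) Lc
            ((unitS₂ (sfStep Lc (m + 1)) (smStep 3 Lc (m + 1)) (T2RecAt 3 Lc (toSite r) cE cVH cΛ cE₂ cB Tc vh₂S (mixFFAt (toSite r) Lc) (m + 1))) κ₁ u₁) κ' u') κ u)) -
          (unitS₂ (sfStep Lc (m + 1)) (smStep 3 Lc (m + 1)) (T2RecAt 3 Lc (toSite r) cE cVH cΛ cE₂ cB Tc vh₂S (mixFFAt (toSite r) Lc) (m + 1)))) -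
      ((fun κ u κ' u' => dressKBmAt (toSite r) Lc (coProjBmAtK (toSite r) Lc (fun κ₁ u₁ => coProjBmAtK (toSite r) Lc
            ((unitS₂ (sfStep Lc m) (smStep 3 Lc m) (T2RecAt 3 Lc (toSite r) cE cVH cΛ cE₂ cB Tc vh₂S (mixFFAt (toSite r) Lc) m)) κ₁ u₁) κ' u') κ u)) -
          (unitS₂ (sfStep Lc m) (smStep 3 Lc m) (T2RecAt 3 Lc (toSite r) cE cVH cΛ cE₂ cB Tc vh₂S (mixFFAt (toSite r) Lc) m)))) (CY' * θY ^ m) δY') (hθY0 : 0 ≤ θY) (hθY1 : θY < 1) (hδY' : 0 < δY') (μ ν : Fin 4) :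
    ∃ κ θ : ℝ, 0 ≤ θ ∧ θ < 1 ∧ AllScalesSeq (fun j => B12Beta.secondMoment (TbalOf Lc (JsRowD1Pin hodd N) j) μ ν) κ θ := by
  have hLc1 : 1 ≤ Lc := le_trans (by norm_num) hLc
  obtain ⟨CB, δB, hδB, hB⟩ := locStencil₂_vh₂SAn1 hodd
  have hB' : LocStencil₂ vh₂S CB δB := by rw [hvh]; exact hB
  have hr : r ∈ box (3 + 1) Lc := by rw [hρ]; exact ctrOff_mem_box (by omega)
  have hBff : ∀ κ u κ' u' x z (α β : Fin (3 + 1)), vh₂S κ u κ' u' x z (Sum.inl α) (Sum.inl β) = 0 := by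
    intro κ u κ' u' x z α β; rw [hvh]; exact vh₂SAn1_inl_inl κ u κ' u' x z α β
  have hBmm : ∀ κ u κ' u' x z (m m' : Fin (3 + 1)), vh₂S κ u κ' u' x z (Sum.inr m) (Sum.inr m') = 0 := by
    intro κ u κ' u' x z m m'; rw [hvh]; exact vh₂SAn1_inr_inr κ u κ' u' x z m m'
  have hBt : ∀ (κ : Fin (3 + 1)) (u : Fin (3 + 1) → ℤ) (κ' : Fin (3 + 1)) (u' t : Fin (3 + 1) → ℤ),
      vh₂S κ (u + (Lc : ℤ) • t) κ' (u' + (Lc : ℤ) • t) = shiftK (-((Lc : ℤ) • t)) (vh₂S κ u κ' u') := by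
    intro κ u κ' u' t; rw [hvh]; exact vh₂SAn1_translate hLc1 κ u κ' u' t
  exact exists_allScalesSeq_JsRowD1Pin_of_F2a_C_QD hodd hLc N hρ hcE hcVH hcΛ hcE₂ hcB hTc hvh
    (hZ_comb_of_S3c hLc hr cE cVH cΛ cE₂ cB Tc hBff hBmm hB' hδB hBt h3) hC hY hδY hYr hθY0 hθY1 hδY' μ ν

end Literal

/-! ## §5 Member `0` of «S3C-REC» — discharged -/

/-- [folklore] the ff-ENTRY of `unitS s_f s_m (SpureRecAt ρ … 0)`: the `vhSAt` border is off the field–field block (`packVH_inl_inl`), so the entry is leaf-19's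
`(s_f s_m)⁻¹·s_f⁻²·cE` times the `wilsonA` entry — the SAME number as for the Stage-B census object `unitS s_f s_m (Spure … 0)` (`WilsonVertexTwoConst.unitS_Spure_zero_inl_inl`). -/
theorem unitS_SpureRecAt_zero_inl_inl (ρ : Fin (d + 1) → ℤ) (sf sm cE cVH cΛ : ℝ) (κ' : Fin (d + 1)) (u w y : Fin (d + 1) → ℤ) (α β : Fin (d + 1)) :
    unitS sf sm (SpureRecAt d Lc ρ cE cVH cΛ 0) κ' u w y (Sum.inl α) (Sum.inl β) =
      (sf * sm)⁻¹ * (sf⁻¹ * sf⁻¹) * cE * wilsonA d κ' u w y (Sum.inl α) (Sum.inl β) := by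
  rw [unitS_inl_inl, SpureRecAt_zero_level]
  simp only [Pi.add_apply, Pi.smul_apply, smul_eq_mul, AveragingHessianKernelsRooted.vhSAt, packVH_inl_inl, mul_zero, add_zero]
  ring

/-- NOT IN PRINT; OUR BOOKKEEPING ([folklore]; leaf-19's `hasSum_wilsonA_legs ∕ _table_left ∕ _table_right` through `unitS_SpureRecAt_zero_inl_inl`).  **MEMBER `0` OF
«S3C-REC»: ALL THREE TWO-CONSTANT-LEG ff CONTRACTIONS OF `unitS s_f s_m (SpureRecAt ρ … 0)` VANISH** — every root `ρ`, all units, all colour constants; the `j = 0` instance of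
§2's ∕ §3's hypothesis `h3`. -/
theorem hasSum_unitS_SpureRecAt_zero (ρ : Fin (d + 1) → ℤ) (sf sm cE cVH cΛ : ℝ) (κ' : Fin (d + 1)) (α β : Fin (d + 1)) (s : Fin (d + 1) → ℤ) :
    HasSum (fun p : (Fin (d + 1) → ℤ) × (Fin (d + 1) → ℤ) =>
        unitS sf sm (SpureRecAt d Lc ρ cE cVH cΛ 0) κ' s p.1 p.2 (Sum.inl α) (Sum.inl β)) 0 ∧
      HasSum (fun p : (Fin (d + 1) → ℤ) × (Fin (d + 1) → ℤ) =>
        unitS sf sm (SpureRecAt d Lc ρ cE cVH cΛ 0) κ' p.1 p.2 s (Sum.inl α) (Sum.inl β)) 0 ∧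
      HasSum (fun p : (Fin (d + 1) → ℤ) × (Fin (d + 1) → ℤ) =>
        unitS sf sm (SpureRecAt d Lc ρ cE cVH cΛ 0) κ' p.1 s p.2 (Sum.inl α) (Sum.inl β)) 0 := by
  simp_rw [unitS_SpureRecAt_zero_inl_inl]
  refine ⟨?_, ?_, ?_⟩
  · simpa using (hasSum_wilsonA_legs κ' s α β).mul_left ((sf * sm)⁻¹ * (sf⁻¹ * sf⁻¹) * cE)
  · simpa using (hasSum_wilsonA_table_left κ' α β s).mul_left ((sf * sm)⁻¹ * (sf⁻¹ * sf⁻¹) * cE)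
  · simpa using (hasSum_wilsonA_table_right κ' α β s).mul_left ((sf * sm)⁻¹ * (sf⁻¹ * sf⁻¹) * cE)

end Summit.QuantumFields.BalabanUV.Beta.GAN24.SourceBracketCombOfS3c

end
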